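import Summits.CriticalPhenomena.PercolationContinuityZ3.Theorems.PercNearOneGluingNoHeavyLowerTailSahiBiChainPullback

/-!
# `NoHeavyLowerTail` (stmt-CriticalPhenomena-4575), P2: a COMMON MODULE does not change any Sahi functional — `E_n` of a family that sees a
# block of coins only through one Boolean statistic `g` equals `E_n` of the quotient family under the product of the coin `P(g = 1)` with the other coins

Support file (seat `prim-masterthm-p2`, gen 15; `--supports stmt-CriticalPhenomena-4575`).  No `sorry`, no definitions, no named facts, standard axioms.
Companion of `…SahiTwoLevelSubsegment` (the `λ = 2` rung is module-stable) and `…SahiBiChainPullback` (`pushWeight_prodMap`).  Memo SAHI-ROUTE.md §4.39(b),(l).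

SETTING.  Two disjoint blocks of independent coins, `ι_B` (weights `q_B`) and `ι_R` (weights `q_R`); a statistic `g : (ι_B → Bool) → Bool` of the first block (ANY map; a
monotone `g` makes pulled-back increasing families increasing) and a family `f_i` on `Bool × (ι_R → Bool)` (the "quotient" family, one macro-coin for the block).  Then
(`sahiE_comp_module`)   `E_n^{q_B ⊗ q_R}(f ∘ (g × id)) = E_n^{Bern(π) ⊗ q_R}(f)`,   `π = P_{q_B}(g = 1)`,
i.e. substituting a common module `x_B ↦ g(x_B)` into all members of a family changes no `E_n` — only the bias of the macro-coin (`pushWeight_coin_bool`: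
the push-forward weight on `Bool` is a coin).  CONSEQUENCES (paper, §4.39): a triple with a
common module has the `E₃` of its quotient, so a minimal counterexample to Kahn's `C₃` (or to Sahi's `C_n` on cubes) is module-free; together with the sub-segment theorem the same
holds for BGC-all / the `λ = 2` rung.  HONEST FRAMING: bookkeeping for the core engine; `C₃` remains OPEN.
[cite: Kahn2022, p. 2 (underlying independents)]; [cite: LiebSahi2021, Def. 3.1].
-/

noncomputable section

open scoped Classical

namespace Summit.CriticalPhenomena.PercolationContinuityZ3.Theorems

namespace SahiBiChainPullback

open Finset Literature.Combinatorics.Sahi2008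

variable {ι_B ι_R : Type*} [Fintype ι_B] [Fintype ι_R]

/-- The push-forward of a block of coins along a Boolean statistic `g` is a coin: `(g_* q)(false) = 1 − (g_* q)(true)` (`(g_* q)(true) = P(g = 1)`).
[folklore] -/
theorem pushWeight_coin_bool (q : ι_B → ℝ) (g : (ι_B → Bool) → Bool) :
    pushWeight (coinWeight q) g false = 1 - pushWeight (coinWeight q) g true := by
  have h := sum_pushWeight (coinWeight q) g
  rw [Fintype.sum_bool, sum_coinWeight] at h
  linarith

/-- **A common module changes no Sahi functional.**  For ANY statistic `g` of the block `ι_B` and any family `f` on `Bool × (ι_R → Bool)`: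
`E_n^{q_B ⊗ q_R}(f ∘ (g × id)) = E_n^{(g_* q_B) ⊗ q_R}(f)`, the macro-coin having the push-forward weight `pushWeight_coin_bool`. [this work] -/
theorem sahiE_comp_module (q_B : ι_B → ℝ) (q_R : ι_R → ℝ) (g : (ι_B → Bool) → Bool) (n : ℕ)
    (f : Fin n → Bool × (ι_R → Bool) → ℝ) :
    sahiE (fun p : (ι_B → Bool) × (ι_R → Bool) => coinWeight q_B p.1 * coinWeight q_R p.2) n (fun i => f i ∘ Prod.map g id) =
      sahiE (fun c : Bool × (ι_R → Bool) => pushWeight (coinWeight q_B) g c.1 * coinWeight q_R c.2) n f := by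
  rw [← sahiE_pushWeight]
  congr 1
  funext c
  rw [pushWeight_prodMap, pushWeight_id]

/-- Hence, for a MONOTONE nonnegative quotient family `f` and any statistic `g`: if `E_n ≥ 0` holds for `f` under every product weight `Bern(π) ⊗ q_R` (e.g. by a theorem on the
smaller cube), it holds for the composed family on the big cube. [this work] -/
theorem sahiE_comp_module_nonneg (q_B : ι_B → ℝ) (q_R : ι_R → ℝ) (g : (ι_B → Bool) → Bool) (n : ℕ)
    (f : Fin n → Bool × (ι_R → Bool) → ℝ)
    (h : ∀ w : Bool → ℝ, 0 ≤ sahiE (fun c : Bool × (ι_R → Bool) => w c.1 * coinWeight q_R c.2) n f) :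
    0 ≤ sahiE (fun p : (ι_B → Bool) × (ι_R → Bool) => coinWeight q_B p.1 * coinWeight q_R p.2) n (fun i => f i ∘ Prod.map g id) := by
  rw [sahiE_comp_module]
  exact h _

end SahiBiChainPullback

end Summit.CriticalPhenomena.PercolationContinuityZ3.Theorems
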